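import Summits.Ventures.QEC.Census.CertBZInfoSets
import Summits.Ventures.QEC.Census.HB.HB90a.BZData
import HarnessLib

/-!
# `HB90a` — `bz` certificate, side X: INFORMATION-SET facts (systematic form), tier KERNEL, file 1/1
# (PARTITION v2.6 item S7.BZI; emitted by qec-search-7)

For each (block `b`, matrix `i`) listed: `cert.bzXSys bzData b i = true` by `decide +kernel` — the matrix
`G_i = A_i · G_b` (rows = the stated XOR-selections of the rows of the block matrix `G_b` = pivot rows of the
stabilizer matrix ++ the block's logical combinations) is SYSTEMATIC on its information set `T_i` (CERT-FORMAT C3: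
`G_i[j][T_i[j']] = [j = j']`, hence `A_i` invertible and every block codeword `c = (c|_T) · G_i` — type-07's
`eq_sum_smul_of_systematic`), and its rows are words `< 2^90`. These are the `hsys` / `hG` inputs of
`BZAssembly.forall_lt_of_bz`, KERNEL-checked independently of the (COMPILED) enumeration verdicts `BZEnumX*.lean`;
`CertBZInfoSets.bzXBlock_of_parts` recombines sys + enum + bound into type-10's `bzXBlock`.
-/

namespace Summit.Ventures.QEC.Census.HB90a

/-- Block 0, matrix 0 (|T| = 45, relRank 45, depth 3): `G` systematic on `T`, rows `< 2^90` (kernel). -/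
theorem sysX_0_0 : HB90a.cert.bzXSys HB90a.bzData 0 0 = true := by decide +kernel

/-- Block 0, matrix 1 (|T| = 45, relRank 45, depth 4): `G` systematic on `T`, rows `< 2^90` (kernel). -/
theorem sysX_0_1 : HB90a.cert.bzXSys HB90a.bzData 0 1 = true := by decide +kernel

/-- Block 1, matrix 0 (|T| = 45, relRank 45, depth 3): `G` systematic on `T`, rows `< 2^90` (kernel). -/
theorem sysX_1_0 : HB90a.cert.bzXSys HB90a.bzData 1 0 = true := by decide +kernel

/-- Block 1, matrix 1 (|T| = 45, relRank 45, depth 4): `G` systematic on `T`, rows `< 2^90` (kernel). -/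
theorem sysX_1_1 : HB90a.cert.bzXSys HB90a.bzData 1 1 = true := by decide +kernel

/-- Block 2, matrix 0 (|T| = 45, relRank 45, depth 3): `G` systematic on `T`, rows `< 2^90` (kernel). -/
theorem sysX_2_0 : HB90a.cert.bzXSys HB90a.bzData 2 0 = true := by decide +kernel

/-- Block 2, matrix 1 (|T| = 45, relRank 45, depth 4): `G` systematic on `T`, rows `< 2^90` (kernel). -/
theorem sysX_2_1 : HB90a.cert.bzXSys HB90a.bzData 2 1 = true := by decide +kernel

end Summit.Ventures.QEC.Census.HB90a
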